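import Mathlib
import Literature.MathematicalPhysics.KineticTheory.FouriersLaw

/-!
# Telescoping of the bulk charge of a coboundary density (stub S2a of crux `DressedCharge`)

Stub `stub_chargeSumCobd` (S2a) of line `birth` of the crux
`Summit.AtomisticToContinuum.FouriersLaw.Theses.HiddenChargeMazur.DressedCharge`
(item stmt-AtomisticToContinuum-13509, route `HiddenChargeMazur`); a `--supports` file, it closes
no item by itself. Pure finite-sum algebra: for a shift-coboundary density
`g(y₀,…,y_{2R}) = k(y₁,…,y_{2R}) − k(y₀,…,y_{2R−1})` the bulk charge
`Q_N(z) = Σ_{x < N−2R} g(z_x,…,z_{x+2R})` (zero-padded site reads, inactive on every window)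
telescopes (`Finset.sum_range_sub`) to `k(last 2R sites) − k(first 2R sites)`.
No measure theory, no named facts, no new definitions; the hypothesis `2R ≤ N` of the registered
signature is not even used (for `N < 2R` both sides read `k(head) − k(head) = 0`).
-/

noncomputable section

open Literature.MathematicalPhysics.KineticTheory.HeatConduction

namespace Summit.AtomisticToContinuum.FouriersLaw.Theorems.DressedCharge

/-- **Telescoping core.** For ANY site read `e : ℕ → ℝ × ℝ`, any `2R`-site profile `k` and any
window count `n`:
`Σ_{x<n} (k(e(x+1),…,e(x+2R)) − k(e(x),…,e(x+2R−1))) = k(e(n),…,e(n+2R−1)) − k(e(0),…,e(2R−1))`,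
where the shifted / unshifted windows are read off the `Fin (2R+1)`-indices `i.succ` and
`Fin.castSucc i` exactly as in the coboundary density `y ↦ k (y ∘ succ) − k (y ∘ castSucc)`.
Proof: the summand is `w (x+1) − w x` for the window profile `w x = k (fun i => e (x + i))`
(`Fin.val_succ`, `Fin.val_castSucc`), then `Finset.sum_range_sub`. -/
theorem sum_window_sub_telescope (R : ℕ) (k : (Fin (2 * R) → ℝ × ℝ) → ℝ) (e : ℕ → ℝ × ℝ)
    (n : ℕ) :
    (∑ x ∈ Finset.range n,
      (k (fun i : Fin (2 * R) => e (x + (i.succ).val)) -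
        k (fun i : Fin (2 * R) => e (x + (Fin.castSucc i).val)))) =
    k (fun i : Fin (2 * R) => e (n + i.val)) - k (fun i : Fin (2 * R) => e i.val) := by
  have hterm : ∀ x ∈ Finset.range n,
      k (fun i : Fin (2 * R) => e (x + (i.succ).val)) -
          k (fun i : Fin (2 * R) => e (x + (Fin.castSucc i).val)) =
        k (fun i : Fin (2 * R) => e (x + 1 + i.val)) - k (fun i : Fin (2 * R) => e (x + i.val)) := by
    intro x _
    have h1 : (fun i : Fin (2 * R) => e (x + (i.succ).val)) =
        fun i : Fin (2 * R) => e (x + 1 + i.val) := by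
      funext i
      exact congrArg e (by rw [Fin.val_succ]; omega)
    have h2 : (fun i : Fin (2 * R) => e (x + (Fin.castSucc i).val)) =
        fun i : Fin (2 * R) => e (x + i.val) := by
      funext i
      exact congrArg e (by rw [Fin.val_castSucc])
    rw [h1, h2]
  rw [Finset.sum_congr rfl hterm,
    Finset.sum_range_sub (fun y => k (fun i : Fin (2 * R) => e (y + i.val))) n]
  simp only [Nat.zero_add]

/-- **Stub S2a `stub_chargeSumCobd` (telescoping).** For every `2R`-site profile `k`, every `N`
with `2R ≤ N` and every configuration `z : PhaseSpace N`, the bulk charge of the coboundary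
density `y ↦ k(y ∘ succ) − k(y ∘ castSucc)`, summed over the windows `x < N − 2R` with the
crux's zero-padded site reads, equals `k` of the last `2R` sites minus `k` of the first `2R`
sites: `Σ_{x<N−2R} (k(z_{x+1..x+2R}) − k(z_{x..x+2R−1})) = k(z_{N−2R..N−1}) − k(z_{0..2R−1})`.
Proof: `sum_window_sub_telescope` for the zero-padded read
`m ↦ if m < N then (q_m, p_m) else (0, 0)` and `n = N − 2R` (definitional instance). -/
theorem stub_chargeSumCobd :
    ∀ (R : ℕ) (k : (Fin (2 * R) → ℝ × ℝ) → ℝ) (N : ℕ), 2 * R ≤ N → ∀ z : PhaseSpace N,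
      (∑ x ∈ Finset.range (N - 2 * R),
        (k (fun i : Fin (2 * R) => if h : x + (i.succ).val < N then (z.1 ⟨x + (i.succ).val, h⟩, z.2 ⟨x + (i.succ).val, h⟩) else (0, 0)) -
          k (fun i : Fin (2 * R) => if h : x + (Fin.castSucc i).val < N then (z.1 ⟨x + (Fin.castSucc i).val, h⟩, z.2 ⟨x + (Fin.castSucc i).val, h⟩) else (0, 0)))) =
      k (fun i : Fin (2 * R) => if h : N - 2 * R + i.val < N then (z.1 ⟨N - 2 * R + i.val, h⟩, z.2 ⟨N - 2 * R + i.val, h⟩) else (0, 0)) -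
        k (fun i : Fin (2 * R) => if h : i.val < N then (z.1 ⟨i.val, h⟩, z.2 ⟨i.val, h⟩) else (0, 0)) := by
  intro R k N _ z
  exact sum_window_sub_telescope R k
    (fun m => if h : m < N then (z.1 ⟨m, h⟩, z.2 ⟨m, h⟩) else (0, 0)) (N - 2 * R)

end Summit.AtomisticToContinuum.FouriersLaw.Theorems.DressedCharge

end
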